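import Literature.AlgebraicGeometry.Resolution.AlterationsNormalizationReduction
import Mathlib.AlgebraicGeometry.Fiber
import Mathlib.AlgebraicGeometry.Morphisms.Smooth
import Mathlib.AlgebraicGeometry.Geometrically.Connected
import HarnessLib

/-!
# De Jong's alteration theorem: the fibration in curves (4.11–4.12) — the step 4.11–4.28 split at 4.12

Topic: `Literature/AlgebraicGeometry/Resolution`. Fourth layer under `AlterationsInduction.lean`:
after the preliminary reductions 4.6–4.10 (all proved, `AlterationsCompactification.lean`,
`AlterationsBlowupDivisor.lean`, `AlterationsNormalizationReduction.lean`, modulo the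
projectivity of blow-ups `BlowupProjectiveOverField`), the printed proof of de Jong 1996,
Thm. 4.1 runs under the standing hypotheses (i) `k` algebraically closed, (iii) `X` projective,
(iv) `Z` the support of a divisor, (v) `X` normal (`DeJong1996.NormalProjectivePair`), and its
remainder 4.11–4.28 is the named fact `DeJong1996NormalProjectiveStep`. Its first move fibres `X`
in curves over `ℙ^{d-1}`:

> "4.11. Lemma. — Suppose the pair `(X, Z)` over `k` satisfies (i)–(iv). There exist a
> modification `φ : X' → X` and a morphism `f : X' → ℙ^{d-1}` of varieties having the following
> properties: (i) There exists a finite subset `S ⊂ Reg(X)`, consisting of closed points,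
> disjoint from `Z`, such that `φ : X' → X` is equal to the blowing up of `X` in `S`. (ii) a) All
> fibres of `f` are equidimensional of dimension 1 and nonempty. b) The smooth locus of `f` is
> dense in all fibres of `f`. c) Let `Z' = φ⁻¹(Z)` […]. The morphism `f|_{Z'} : Z' → ℙ^{d-1}` is
> finite and étale over an open subscheme of `ℙ^{d-1}`. If `X` is normal, i.e. if `(X, Z)`
> satisfies (v), then we may choose `φ` and `f` such that in addition we have d) At least one
> fibre of `f` is smooth."
>
> "4.12. Assume (i)–(v) and apply 4.11. […] Note that `X'` is normal also. We remark that `f`,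
> having one nonsingular fibre and `ℙ^{d-1}` being nonsingular imply that `f` is smooth over a
> nonempty open part of `ℙ^{d-1}`, see 2.8. […] Let `X' → Y' → ℙ^{d-1}` be the Stein
> factorization of `f`. Note that `Y' → ℙ^{d-1}` is (finite) étale […]. We conclude that
> `Y' = ℙ^{d-1}`, hence all fibres of `f` are geometrically connected. By replacing `(X, Z)` by
> `(X', Z')`, see 4.4 and 4.10, we may assume we have (i)–(v) and the following property:
> (vi) There exists a morphism `f : X → Y` of projective varieties such that: (vi) a) All fibres
> are nonempty, geometrically connected and equidimensional of dimension 1. (vi) b) The smooth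
> locus of `f` is dense in all fibres. (vi) c) The generic fibre of `f` is smooth. (vi) d) The
> morphism `f|_Z : Z → Y` is finite and generically etale."

This file renders (vi) a)–d) on Mathlib's scheme-theoretic fibres (`Scheme.Hom.fiber`,
`Scheme.Hom.fiberι`, `Scheme.Hom.fiberToSpecResidueField`), smooth locus
(`Scheme.Hom.smoothLocus`), geometric connectedness (`GeometricallyConnected`: every base change
to the spectrum of a field is connected, equivalently all fibres are geometrically connected,
`GeometricallyConnected.iff_geometricallyConnected_fiber`) and smoothness (`Smooth`), and the
reduced closed subscheme structure on `Z` (`Scheme.IdealSheafData.vanishingIdeal`,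
`subschemeι`, de Jong 2.2), and splits `DeJong1996NormalProjectiveStep` accordingly:

* `DeJong1996.IsCurveFibration f` — (vi) a), b), c) for `f : X → Y`;
  `DeJong1996.IsFiniteGenericallyEtaleOn f Z` — (vi) d); `DeJong1996.SituationVI fX Z` — the
  pair `(X → Spec k, Z)` satisfies (iii), (iv), (v) and admits `f : X → Y` over `k` to a
  projective variety `Y` with (vi) a)–d).
* `DeJong1996FibrationReduction` — NAMED FACT, 4.11–4.12 (with 4.4, 4.10): a normal projective
  pair of dimension `≥ 1` is dominated, along a generically étale alteration `φ : X' → X`, by a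
  pair `(X', φ⁻¹Z)` in situation (vi).
* `DeJong1996NormalProjectiveStepVI` — NAMED FACT, 4.13–4.28: the induction step for pairs in
  situation (vi) (the multisection Lemma 4.13 and 4.14, 4.15–4.17, the three-point Lemma
  4.18–4.21, the induction hypothesis 4.22, semi-stable resolution 4.23–4.28 with §3).
* PROVED: `DeJong1996NormalProjectiveStep.of_fibration_of_stepVI` (4.4 once more:
  `DeJong1996.ConclusionGenericallyEtale.of_isAlteration`, `IsAlteration.topologicalKrullDim_eq`),
  whence `DeJong1996StrongAlgClosed`, `DeJong1996Strong`, `DeJong1996StrongPerfect` from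
  `BlowupProjectiveOverField`, the two facts and (for the latter two) `DeJong1996Descent`.

## Sources

* A. J. de Jong, *Smoothness, semi-stability and alterations*, Publ. Math. IHÉS 83 (1996) 51–93:
  2.2, 2.5 (smooth locus), 2.6 (generically étale), 2.8, 2.11, 2.20 (pp. 54–61), 4.4 (p. 66),
  Lemma 4.11 and 4.12 (pp. 67–69), 4.13–4.28 (pp. 69–76).
* The Stacks Project, Tag 0362 (geometrically connected), Tag 01V5 (smooth locus).
-/

noncomputable section

open CategoryTheory CategoryTheory.Limits AlgebraicGeometry TopologicalSpace Topology

namespace Literature.AlgebraicGeometry.Resolution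

universe u

namespace DeJong1996

/-! ## (vi) a)–d) -/

/-- **de Jong 1996, 4.12 (vi) a)–c)** for a morphism `f : X → Y` (with `Y` irreducible, so that
its generic fibre makes sense): "(vi) a) All fibres are nonempty, geometrically connected and
equidimensional of dimension 1. (vi) b) The smooth locus of `f` is dense in all fibres. (vi) c)
The generic fibre of `f` is smooth." Fibres are Mathlib's scheme-theoretic fibres
`f.fiber y = X ×_Y Spec κ(y)` at all points `y ∈ Y` (embedded by `f.fiberι y`, a homeomorphism
onto `f⁻¹{y}`); "geometrically connected" is Mathlib's `GeometricallyConnected f` (Stacks 0362);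
"equidimensional of dimension 1" = every irreducible component of every fibre has dimension
`1`; the smooth locus is `f.smoothLocus` (2.5; it needs `f` locally of finite presentation,
recorded as the first field); the generic fibre is the fibre at the generic point of `Y`.
[cite: DeJong1996, 4.12 (vi) a)–c), p. 69] -/
structure IsCurveFibration {X Y : Scheme.{u}} [IrreducibleSpace Y] (f : X ⟶ Y) : Prop where
  /-- `f` is locally of finite presentation (automatic for varieties; needed for `smoothLocus`) -/
  locallyOfFinitePresentation : LocallyOfFinitePresentation f
  /-- (vi) a): all fibres are non-empty -/
  surjective : Surjective f
  /-- (vi) a): all fibres are geometrically connected -/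
  geometricallyConnected : GeometricallyConnected f
  /-- (vi) a): all fibres are equidimensional of dimension `1` -/
  topologicalKrullDim_eq_one : ∀ (y : Y), ∀ C ∈ irreducibleComponents (f.fiber y),
    topologicalKrullDim C = 1
  /-- (vi) b): the smooth locus of `f` is dense in every fibre -/
  dense_preimage_smoothLocus : ∀ y : Y,
    Dense ((f.fiberι y) ⁻¹' ((@Scheme.Hom.smoothLocus X Y f locallyOfFinitePresentation :
      X.Opens) : Set X))
  /-- (vi) c): the generic fibre is smooth -/
  smooth_fiberToSpecResidueField_genericPoint :
    Smooth (f.fiberToSpecResidueField (genericPoint Y))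

/-- **de Jong 1996, 4.12 (vi) d)**: "The morphism `f|_Z : Z → Y` is finite and generically
etale", where the closed subset `Z ⊂ X` carries its reduced closed subscheme structure (2.2;
Mathlib: the subscheme of the vanishing ideal sheaf of `closure Z = Z`) and "generically étale"
is 2.6 (`IsGenericallyEtale`: étale on an open dense subscheme of `Z`).
[cite: DeJong1996, 4.12 (vi) d), p. 69] -/
def IsFiniteGenericallyEtaleOn {X Y : Scheme.{u}} (f : X ⟶ Y) (Z : Set X) : Prop :=
  IsFinite ((Scheme.IdealSheafData.vanishingIdeal ⟨closure Z, isClosed_closure⟩).subschemeι ≫ f) ∧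
    IsGenericallyEtale
      ((Scheme.IdealSheafData.vanishingIdeal ⟨closure Z, isClosed_closure⟩).subschemeι ≫ f)

/-- **The situation after 4.12**: the pair `(X → Spec k, Z)` satisfies (iii) `X` projective,
(iv) `Z` the support of a divisor, (v) `X` normal (`NormalProjectivePair`), and "(vi) There
exists a morphism `f : X → Y` of projective varieties such that (vi) a)–d)" — `Y` an integral
scheme projective over `k`, `f` a `k`-morphism. [cite: DeJong1996, 4.12, p. 69] -/
structure SituationVI {k : Type u} [Field k] {X : Scheme.{u}} (fX : X ⟶ Spec (.of k))
    (Z : Set X) : Prop where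
  /-- (iii), (iv), (v) -/
  normalProjectivePair : NormalProjectivePair fX Z
  /-- (vi): a fibration in curves over a projective variety `Y`, over `k`, with a)–d) -/
  exists_isCurveFibration : ∃ (Y : Scheme.{u}) (_ : IsIntegral Y) (g : Y ⟶ Spec (.of k))
    (f : X ⟶ Y), Motives.IsProjectiveOver (Over.mk g) ∧ f ≫ g = fX ∧ IsCurveFibration f ∧
      IsFiniteGenericallyEtaleOn f Z

end DeJong1996

/-! ## 4.11–4.12 and 4.13–4.28 as named facts -/

/-- NAMED FACT — **de Jong 1996, Lemma 4.11 with 4.12: fibring a normal projective pair in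
curves.** Over an algebraically closed field `k`, let `(X, Z)` satisfy (iii), (iv), (v)
(`DeJong1996.NormalProjectivePair`) with `dim X ≥ 1`. Then there is a generically étale
alteration `φ : X' → X` (printed: the blowing up of `X` in a finite set of nonsingular closed
points off `Z`, a modification) such that the pair `(X', φ⁻¹(Z))` again satisfies (iii), (iv),
(v) ("Note that `X'` is normal also"; 4.10) and admits a `k`-morphism `f : X' → Y` to a
projective variety (printed: `Y = ℙ^{d-1}`, after the Stein factorisation `X' → Y' → ℙ^{d-1}`
with `Y' → ℙ^{d-1}` finite étale, hence an isomorphism) with "(vi) a) All fibres are nonempty,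
geometrically connected and equidimensional of dimension 1. (vi) b) The smooth locus of `f` is
dense in all fibres. (vi) c) The generic fibre of `f` is smooth. (vi) d) The morphism
`f|_Z : Z → Y` is finite and generically etale" — `DeJong1996.SituationVI`. ("By replacing
`(X, Z)` by `(X', Z')`, see 4.4 and 4.10, we may assume we have (i)–(v) and […] (vi)".) Inputs
of the printed proof: generic linear projections (2.11), blowing up points, Bertini, 2.8, Stein
factorisation and the simple connectedness of `ℙ^{d-1}` ([18] = SGA 1). Users take
`(h : DeJong1996FibrationReduction)`. [cite: DeJong1996, Lemma 4.11 and 4.12, pp. 67–69] -/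
def DeJong1996FibrationReduction : Prop :=
  ∀ (k : Type u) [Field k] [IsAlgClosed k] (X : Scheme.{u}) (fX : X ⟶ Spec (.of k)) (Z : Set X),
    DeJong1996.NormalProjectivePair fX Z → 1 ≤ topologicalKrullDim X →
      ∃ (X' : Scheme.{u}) (φ : X' ⟶ X), IsAlteration φ ∧ IsGenericallyEtale φ ∧
        DeJong1996.SituationVI (φ ≫ fX) (φ ⁻¹' Z)

/-- NAMED FACT — **de Jong 1996, 4.13–4.28: the induction step for pairs fibred in curves.**
Over an algebraically closed field `k`, assume Thm. 4.1 with its generically-étale clause for all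
pairs `(Y, D)` over `k` with `dim Y ≤ d` (`DeJong1996.StatementUpToDim k d`, consumed in 4.22).
Then Thm. 4.1 with the clause holds for every pair `(X, Z)` over `k` in situation (vi)
(`DeJong1996.SituationVI`: (iii), (iv), (v) and a fibration `f : X → Y` in curves over a
projective variety with (vi) a)–d)) and `dim X = d + 1`. This is the content of the multisection
Lemma 4.13 and 4.14 ((vi) e): three smooth points of `Z` on every component of every geometric
fibre, via 4.9), 4.15 (generically étale projective alterations of `Y` and strict transforms),
4.16 (Galois normalisation: `Z` a union of sections, (vi) f)), 4.17 (the projective level-`ℓ`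
moduli scheme of stable `n`-pointed curves, 2.24, (vi) g)), 4.18–4.21 (flattening 2.19 and the
three-point Lemma 4.20: `β : 𝒞 ⇢ X` extends after a modification of `Y`), 4.22 (the induction
hypothesis for `(Y, D)`, `dim Y = d`), and 4.23–4.28 with Lemma 3.2 and 3.5 (resolution of the
split semi-stable curve over a nonsingular base degenerating over a strict normal crossings
divisor; strictification 2.4). Users take `(h : DeJong1996NormalProjectiveStepVI)`; it is the
node to decompose further (next notions needed: stable pointed curves 2.24, semi-stable curves
2.21–2.23, strict transforms 2.18). [cite: DeJong1996, 4.13–4.28, pp. 69–76] -/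
def DeJong1996NormalProjectiveStepVI : Prop :=
  ∀ (k : Type u) [Field k] [IsAlgClosed k] (d : ℕ), DeJong1996.StatementUpToDim k d →
    ∀ (X : Scheme.{u}) (fX : X ⟶ Spec (.of k)) (Z : Set X), DeJong1996.SituationVI fX Z →
      topologicalKrullDim X = (d + 1 : ℕ) → DeJong1996.ConclusionGenericallyEtale fX Z

/-! ## The assembly -/

/-- **`DeJong1996NormalProjectiveStep` (4.11–4.28) from its two halves 4.11–4.12 and 4.13–4.28**:
given a normal projective pair `(X, Z)` of dimension `d + 1 ≥ 1`, fibre it in curves after a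
generically étale alteration `φ : X' → X` (`DeJong1996FibrationReduction`), apply the step for
pairs in situation (vi) to `(X', φ⁻¹Z)` — `dim X' = dim X` (2.20,
`IsAlteration.topologicalKrullDim_eq`) — and descend along `φ` by 4.4
(`DeJong1996.ConclusionGenericallyEtale.of_isAlteration`).
[cite: DeJong1996, 4.11–4.12, pp. 67–69] -/
theorem DeJong1996NormalProjectiveStep.of_fibration_of_stepVI
    (h₁ : DeJong1996FibrationReduction.{u}) (h₂ : DeJong1996NormalProjectiveStepVI.{u}) :
    DeJong1996NormalProjectiveStep.{u} := by
  intro k _ _ d ih X f Z hP hdim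
  haveI := hP.isIntegral
  haveI := hP.isProper
  have h1 : (1 : WithBot ℕ∞) ≤ topologicalKrullDim X := by
    rw [hdim]
    exact_mod_cast Nat.succ_le_succ (Nat.zero_le d)
  obtain ⟨X', φ, hφ, hφe, hVI⟩ := h₁ k X f Z hP h1
  refine DeJong1996.ConclusionGenericallyEtale.of_isAlteration hφ hφe ?_
  exact h₂ k d ih X' (φ ≫ f) (φ ⁻¹' Z) hVI (by rw [hφ.topologicalKrullDim_eq f, hdim])

/-- The induction step of Thm. 4.1 from the projectivity of blow-ups (Hartshorne II.7.16 (c)),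
the fibration 4.11–4.12 and the step 4.13–4.28. [cite: DeJong1996, 4.6–4.12, pp. 66–69] -/
theorem DeJong1996InductionStep.of_blowupProjective_of_fibration_of_stepVI
    (hB : BlowupProjectiveOverField.{u}) (h₁ : DeJong1996FibrationReduction.{u})
    (h₂ : DeJong1996NormalProjectiveStepVI.{u}) : DeJong1996InductionStep.{u} :=
  DeJong1996InductionStep.of_blowupProjective_of_step hB
    (DeJong1996NormalProjectiveStep.of_fibration_of_stepVI h₁ h₂)

/-- **`DeJong1996StrongAlgClosed` (Thm. 4.1 with its generically-étale clause over algebraically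
closed fields) from three named inputs**: projectivity of blow-ups (`BlowupProjectiveOverField`),
de Jong's Lemma 4.11 with 4.12 (`DeJong1996FibrationReduction`) and 4.13–4.28
(`DeJong1996NormalProjectiveStepVI`) — 4.3, 4.4, 4.6–4.10 and the induction being proved.
[cite: DeJong1996, 4.3–4.12, pp. 66–69] -/
theorem DeJong1996StrongAlgClosed.of_blowupProjective_of_fibration_of_stepVI
    (hB : BlowupProjectiveOverField.{u}) (h₁ : DeJong1996FibrationReduction.{u})
    (h₂ : DeJong1996NormalProjectiveStepVI.{u}) : DeJong1996StrongAlgClosed.{u} :=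
  DeJong1996StrongAlgClosed.of_inductionStep
    (DeJong1996InductionStep.of_blowupProjective_of_fibration_of_stepVI hB h₁ h₂)

/-- Thm. 4.1 (i)+(ii) over every field from 4.5 (`DeJong1996Descent`) and the three inputs.
[cite: DeJong1996, 4.3–4.12, pp. 66–69] -/
theorem DeJong1996Strong.of_descent_of_blowupProjective_of_fibration_of_stepVI
    (h45 : DeJong1996Descent.{u}) (hB : BlowupProjectiveOverField.{u})
    (h₁ : DeJong1996FibrationReduction.{u}) (h₂ : DeJong1996NormalProjectiveStepVI.{u}) :
    DeJong1996Strong.{u} :=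
  DeJong1996Strong.of_descent_of_inductionStep h45
    (DeJong1996InductionStep.of_blowupProjective_of_fibration_of_stepVI hB h₁ h₂)

/-- The last sentence of Thm. 4.1 (perfect fields) from the same inputs.
[cite: DeJong1996, 4.3–4.12, pp. 66–69] -/
theorem DeJong1996StrongPerfect.of_descent_of_blowupProjective_of_fibration_of_stepVI
    (h45 : DeJong1996Descent.{u}) (hB : BlowupProjectiveOverField.{u})
    (h₁ : DeJong1996FibrationReduction.{u}) (h₂ : DeJong1996NormalProjectiveStepVI.{u}) :
    DeJong1996StrongPerfect.{u} :=
  DeJong1996StrongPerfect.of_descent_of_inductionStep h45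
    (DeJong1996InductionStep.of_blowupProjective_of_fibration_of_stepVI hB h₁ h₂)

end Literature.AlgebraicGeometry.Resolution

end
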